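import Mathlib
import HarnessLib

/-!
# Crux `NewtonUnitEquations.DissociatedUniform` (stmt-ValiantsHypothesis-5905): the pointwise union vertex bound is FALSE —
# part 1/3, the planar inequalities of the counterexample family

The located pointwise rung `@[conjecture] UnionVertBound C` of `…TotalsLawUnionVertBound` (`#vert conv U_s(Z) ≤ C·|G|` for all
finite abelian `G`, all `a b : G → ℝ²`, all `Z`, `s`; census `3q − 1` for `q ≤ 9`) fails for EVERY `C`: part 3/3
(`…TotalsLawUnionVertLower`) proves `∀ C, ¬ UnionVertBound C` and the quantitative family `|G|⁴ ≤ 1024·(#vert conv U_s(Z))³`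
(so the pointwise truth is `Θ(|G|^{4/3})`, the exponent of the tree's Eisenbrand–Pach–Rothvoß–Sopher bound `48|G|^{4/3}`,
`…TotalsLawUnionEPRS`).  The family (parameter `m ≥ 1`; `k = 2m`, `K = 8m²`, `G = ℤ/k × ℤ/K`, `|G| = 16m³`):
* `B` = the `k × K` grid `(c, r)` sent through the projective map `(c, r) ↦ (Pc, Pr)/(P + r)` (`P = 32m³`) and the
  convexification `(X, Y) ↦ (X, Y + X²/M)` (`M = 1024m⁴`), with the PARABOLIC relabelling `label (i, j) ↦ grid (i, j + i(i+k))`;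
* position set = the anti-parabola `{(-i, i(i+k))}`, so that class `0` is `U = {a x + b y : x + y = (i, -i(i+k))}` and the cluster
  of `x` (`-x = (u, ·)`) is the grid LINE `r = 2uc + c₁` on the columns `c ≥ u` plus points `2k(u - c) > 0` rows ABOVE it on the
  columns `c < u`: every translate of the position set is a rich line of its own slope `2uP/(P + c₁)` (pairwise distinct after
  the projective map), carrying its cluster on one side;
* `A` = the points `Λ(t, t²/2)` (`Λ = 524288m⁸`) at the parameters `t = 2uP/(P + c₁)` of the clusters, so that the weight
  `(σ, -1)` with `σ` within `1/(8P)` of `t_x` selects cluster `x` with margin `4K`.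
Then every grid point `(j, 2uj + c₁)` with `1 ≤ u ≤ m`, `c₁ < k²`, `m ≤ j < k` is the STRICT top of `U` for the weight
`(2uP/(P+c₁) + 2X_j/M, -1)` — `4m⁴ = |G|·k/8` hull vertices.

This file: the elementary real inequalities only (no groups): the projective grid point `gridPt`, its score `gval` against
`(σ, -1)`, the COLLINEARITY identity of a grid line after the projective map (`line_identity`), the exact concave-quadratic form
of the score along a line (`gval_chain`, strict maximality `gval_chain_lt`), monotonicity of the score in the row
(`gval_lt_of_row_add`: points above the line score less), crude score bounds (`gval_le`, `neg_le_gval`), the parabola points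
`apt` of `A` with their exact score difference (`apt_score_sub`) and margin (`apt_gap`), and the separation of the cluster
parameters `2uP/(P+c)` (`param_sep`).  Honest label: a refutation tool; `UnionTotalsLaw`, `TotalsLawThree` remain OPEN;
nothing here bears on VP ≠ VNP.
[folklore: elementary algebra of the projective image of a grid]
-/

set_option linter.dupNamespace false -- `ValiantsHypothesis.ValiantsHypothesis` (summit = problem) in every name

namespace Summit.ValiantsHypothesis.ValiantsHypothesis.Theorems.NewtonUnitEquationsDissociatedUniform

namespace TotalsLaw

namespace UVBCex

/-! ### The projective grid point and its score -/

/-- Abscissa `X = P·c/(P + r)` of the projective image of the grid point `(c, r)`. -/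
noncomputable def pX (P c r : ℝ) : ℝ := P * c / (P + r)

/-- The grid point `(c, r)` after the projective map `(c, r) ↦ (Pc, Pr)/(P + r)` and the convexification
`(X, Y) ↦ (X, Y + X²/M)`. -/
noncomputable def gridPt (P M c r : ℝ) : Fin 2 → ℝ := ![pX P c r, P * r / (P + r) + pX P c r ^ 2 / M]

/-- The score of `gridPt P M c r` against the weight `(σ, -1)`. -/
noncomputable def gval (P M σ c r : ℝ) : ℝ := σ * pX P c r - P * r / (P + r) - pX P c r ^ 2 / M

/-- Pairing of a weight `(σ, -1)` with a planar point. [folklore] -/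
theorem dot_vec2 (σ e f : ℝ) : ![σ, -1] ⬝ᵥ ![e, f] = σ * e - f := by
  simp [dotProduct, Fin.sum_univ_two]; ring

/-- The score of a grid point is `gval`. -/
theorem dot_gridPt (P M σ c r : ℝ) : ![σ, -1] ⬝ᵥ gridPt P M c r = gval P M σ c r := by
  rw [gridPt, dot_vec2, gval]; ring

/-- `0 ≤ X` for the abscissa of a grid point with `c, r ≥ 0`. -/
theorem pX_nonneg {P c r : ℝ} (hP : 0 < P) (hc : 0 ≤ c) (hr : 0 ≤ r) : 0 ≤ pX P c r := by
  unfold pX; positivity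

/-- `X ≤ c`. -/
theorem pX_le {P c r : ℝ} (hP : 0 < P) (hc : 0 ≤ c) (hr : 0 ≤ r) : pX P c r ≤ c := by
  unfold pX
  rw [div_le_iff₀ (by linarith)]
  nlinarith

/-- The abscissa decreases with the row. -/
theorem pX_le_pX_of_le {P c r r' : ℝ} (hP : 0 < P) (hc : 0 ≤ c) (hr : 0 ≤ r) (hrr' : r ≤ r') :
    pX P c r' ≤ pX P c r := by
  unfold pX
  exact div_le_div_of_nonneg_left (by positivity) (by linarith) (by linarith)

/-! ### A grid line after the projective map: collinearity and the concave-quadratic score -/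

/-- **Collinearity.**  On the grid line `r = 2uc + c₁` the projective image satisfies `Pr/(P+r) = σ₀·X + κ` with the slope
`σ₀ = 2uP/(P + c₁)` and intercept `κ = Pc₁/(P + c₁)` (independent of `c`). -/
theorem line_identity {P u c c₁ : ℝ} (hP : 0 < P) (hu : 0 ≤ u) (hc : 0 ≤ c) (hc₁ : 0 ≤ c₁) :
    P * (2 * u * c + c₁) / (P + (2 * u * c + c₁)) =
      2 * u * P / (P + c₁) * pX P c (2 * u * c + c₁) + P * c₁ / (P + c₁) := by
  unfold pX
  have h1 : P + (2 * u * c + c₁) ≠ 0 := by positivity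
  have h2 : P + c₁ ≠ 0 := by positivity
  field_simp
  ring

/-- **Score along a line.**  With the weight slope `σ = σ₀ + 2X₀/M`, the score of the line point of column `c` is
`(X₀² − (X_c − X₀)²)/M − κ`: a concave quadratic in the abscissa, maximal exactly at `X_c = X₀`. -/
theorem gval_chain {P M u c c₁ : ℝ} (hP : 0 < P) (hM : M ≠ 0) (hu : 0 ≤ u) (hc : 0 ≤ c) (hc₁ : 0 ≤ c₁) (X₀ : ℝ) :
    gval P M (2 * u * P / (P + c₁) + 2 * X₀ / M) c (2 * u * c + c₁) =
      (X₀ ^ 2 - (pX P c (2 * u * c + c₁) - X₀) ^ 2) / M - P * c₁ / (P + c₁) := by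
  rw [gval, line_identity hP hu hc hc₁]
  field_simp
  ring

/-- Distinct columns of one line have distinct abscissae. -/
theorem pX_chain_ne {P u c c' c₁ : ℝ} (hP : 0 < P) (hu : 0 ≤ u) (hc : 0 ≤ c) (hc' : 0 ≤ c') (hc₁ : 0 ≤ c₁)
    (hne : c ≠ c') : pX P c (2 * u * c + c₁) ≠ pX P c' (2 * u * c' + c₁) := by
  unfold pX
  intro h
  have h1 : P + (2 * u * c + c₁) ≠ 0 := by positivity
  have h2 : P + (2 * u * c' + c₁) ≠ 0 := by positivity
  rw [div_eq_div_iff h1 h2] at h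
  have h3 : P * (P + c₁) * (c - c') = 0 := by linear_combination h
  rcases mul_eq_zero.1 h3 with h4 | h4
  · exact absurd h4 (by positivity)
  · exact hne (by linarith)

/-- **Strict maximality along the line**: every other column of the line scores strictly less than column `c₀` for the
weight slope `σ₀ + 2X_{c₀}/M`. -/
theorem gval_chain_lt {P M u c c₀ c₁ : ℝ} (hP : 0 < P) (hM : 0 < M) (hu : 0 ≤ u) (hc : 0 ≤ c) (hc₀ : 0 ≤ c₀)
    (hc₁ : 0 ≤ c₁) (hne : c ≠ c₀) :
    gval P M (2 * u * P / (P + c₁) + 2 * pX P c₀ (2 * u * c₀ + c₁) / M) c (2 * u * c + c₁) <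
      gval P M (2 * u * P / (P + c₁) + 2 * pX P c₀ (2 * u * c₀ + c₁) / M) c₀ (2 * u * c₀ + c₁) := by
  rw [gval_chain hP hM.ne' hu hc hc₁, gval_chain hP hM.ne' hu hc₀ hc₁, sub_self, zero_pow two_ne_zero, sub_zero]
  have hne' := pX_chain_ne hP hu hc hc₀ hc₁ hne
  have hpos : 0 < (pX P c (2 * u * c + c₁) - pX P c₀ (2 * u * c₀ + c₁)) ^ 2 :=
    sq_pos_of_ne_zero (sub_ne_zero.2 hne')
  have : (pX P c₀ (2 * u * c₀ + c₁) ^ 2 - (pX P c (2 * u * c + c₁) - pX P c₀ (2 * u * c₀ + c₁)) ^ 2) / M <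
      pX P c₀ (2 * u * c₀ + c₁) ^ 2 / M := by
    apply div_lt_div_of_pos_right _ hM
    linarith
  linarith

/-- The score along the line never exceeds the score of the distinguished column. -/
theorem gval_chain_le {P M u c c₀ c₁ : ℝ} (hP : 0 < P) (hM : 0 < M) (hu : 0 ≤ u) (hc : 0 ≤ c) (hc₀ : 0 ≤ c₀)
    (hc₁ : 0 ≤ c₁) :
    gval P M (2 * u * P / (P + c₁) + 2 * pX P c₀ (2 * u * c₀ + c₁) / M) c (2 * u * c + c₁) ≤
      gval P M (2 * u * P / (P + c₁) + 2 * pX P c₀ (2 * u * c₀ + c₁) / M) c₀ (2 * u * c₀ + c₁) := by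
  by_cases hne : c = c₀
  · rw [hne]
  · exact (gval_chain_lt hP hM hu hc hc₀ hc₁ hne).le

/-! ### Points above a line score less -/

/-- **Monotonicity in the row.**  For a weight slope `σ ≥ 0`, raising the row of a grid point of column `c ≤ k` by `d ≥ 2k`
(rows staying `≤ P`) strictly lowers the score, provided `4k² ≤ M` and `1 ≤ k`. -/
theorem gval_lt_of_row_add {P M σ c r d k : ℝ} (hP : 0 < P) (hM : 0 < M) (hσ : 0 ≤ σ) (hk : 1 ≤ k) (hc : 0 ≤ c)
    (hck : c ≤ k) (hr : 0 ≤ r) (hd : 2 * k ≤ d) (hrd : r + d ≤ P) (hMk : 4 * k ^ 2 ≤ M) :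
    gval P M σ c (r + d) < gval P M σ c r := by
  have hd0 : 0 ≤ d := by linarith
  have hX₂le : pX P c (r + d) ≤ pX P c r := pX_le_pX_of_le hP hc hr (by linarith)
  have hX₂nn : 0 ≤ pX P c (r + d) := pX_nonneg hP hc (by linarith)
  have hX₁le : pX P c r ≤ k := (pX_le hP hc hr).trans hck
  -- the projective row term drops by at least `d/4`
  have hrow : P * r / (P + r) + d / 4 ≤ P * (r + d) / (P + (r + d)) := by
    rw [div_add_div _ _ (by positivity) (by norm_num), div_le_div_iff₀ (by positivity) (by positivity)]
    have h1 : (P + r) * (P + r + d) ≤ 4 * P ^ 2 := by nlinarith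
    have h2 : 0 ≤ d * (P + r) * (4 * P ^ 2 - (P + r) * (P + r + d)) :=
      mul_nonneg (mul_nonneg hd0 (by linarith)) (by linarith)
    nlinarith [h2]
  -- the convexification term moves by at most `k²/M ≤ 1/4`
  have hsq : pX P c r ^ 2 / M ≤ 1 / 4 := by
    rw [div_le_div_iff₀ hM (by norm_num)]
    have : pX P c r ^ 2 ≤ k ^ 2 := pow_le_pow_left₀ (pX_nonneg hP hc hr) hX₁le 2
    nlinarith
  have hsq' : 0 ≤ pX P c (r + d) ^ 2 / M := by positivity
  unfold gval
  nlinarith [mul_le_mul_of_nonneg_left hX₂le hσ]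

/-! ### Crude bounds on the score of a grid point -/

/-- Upper bound: `gval ≤ σ·k` for `σ ≥ 0`, column `≤ k`, row `≥ 0`, `M > 0`. -/
theorem gval_le {P M σ c r k : ℝ} (hP : 0 < P) (hM : 0 < M) (hσ : 0 ≤ σ) (hc : 0 ≤ c) (hck : c ≤ k) (hr : 0 ≤ r) :
    gval P M σ c r ≤ σ * k := by
  unfold gval
  have h1 : σ * pX P c r ≤ σ * k := mul_le_mul_of_nonneg_left ((pX_le hP hc hr).trans hck) hσ
  have h2 : 0 ≤ P * r / (P + r) := by positivity
  have h3 : 0 ≤ pX P c r ^ 2 / M := by positivity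
  linarith

/-- Lower bound: `-(K + 1) ≤ gval` for `σ ≥ 0`, column in `[0, k]`, row in `[0, K]`, `k² ≤ M`. -/
theorem neg_le_gval {P M σ c r k K : ℝ} (hP : 0 < P) (hM : 0 < M) (hσ : 0 ≤ σ) (hc : 0 ≤ c) (hck : c ≤ k) (hr : 0 ≤ r)
    (hrK : r ≤ K) (hMk : k ^ 2 ≤ M) : -(K + 1) ≤ gval P M σ c r := by
  unfold gval
  have h1 : 0 ≤ σ * pX P c r := mul_nonneg hσ (pX_nonneg hP hc hr)
  have h2 : P * r / (P + r) ≤ K := by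
    rw [div_le_iff₀ (by positivity)]
    nlinarith
  have h3 : pX P c r ^ 2 / M ≤ 1 := by
    rw [div_le_one hM]
    exact (pow_le_pow_left₀ (pX_nonneg hP hc hr) ((pX_le hP hc hr).trans hck) 2).trans hMk
  linarith

/-! ### The far parabola `A` -/

/-- The point `Λ·(t, t²/2)` of the far parabola. -/
noncomputable def apt (Λ t : ℝ) : Fin 2 → ℝ := ![Λ * t, Λ * t ^ 2 / 2]

/-- Its score against `(σ, -1)` is `Λ(σt − t²/2)`. -/
theorem dot_apt (Λ σ t : ℝ) : ![σ, -1] ⬝ᵥ apt Λ t = Λ * (σ * t - t ^ 2 / 2) := by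
  rw [apt, dot_vec2]; ring

/-- The exact score difference of two parabola points: `(Λ/2)((σ − t')² − (σ − t)²)`. -/
theorem apt_score_sub (Λ σ t t' : ℝ) :
    Λ * (σ * t - t ^ 2 / 2) - Λ * (σ * t' - t' ^ 2 / 2) = Λ / 2 * ((σ - t') ^ 2 - (σ - t) ^ 2) := by
  ring

/-- **The selection margin.**  If `σ` is within `δ` above `t` and `t'` is at least `Δ ≥ δ` away from `t`, the parabola point
of parameter `t` beats the one of parameter `t'` by at least `(Λ/2)((Δ − δ)² − δ²)`. -/
theorem apt_gap {Λ σ t t' δ Δ : ℝ} (hΛ : 0 ≤ Λ) (he : 0 ≤ σ - t) (heδ : σ - t ≤ δ) (hδΔ : δ ≤ Δ)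
    (hsep : Δ ≤ |t - t'|) :
    Λ / 2 * ((Δ - δ) ^ 2 - δ ^ 2) ≤ Λ * (σ * t - t ^ 2 / 2) - Λ * (σ * t' - t' ^ 2 / 2) := by
  rw [apt_score_sub]
  apply mul_le_mul_of_nonneg_left _ (by positivity)
  have h1 : Δ - δ ≤ |σ - t'| := by
    have h2 : |t - t'| - |t - σ| ≤ |σ - t'| := by
      have := abs_sub_abs_le_abs_sub (t - t') (t - σ)
      rwa [show t - t' - (t - σ) = σ - t' by ring] at this
    have h3 : |t - σ| ≤ δ := by rw [abs_sub_comm, abs_of_nonneg he]; exact heδ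
    linarith
  have h4 : (Δ - δ) ^ 2 ≤ (σ - t') ^ 2 := by
    rw [← sq_abs (σ - t')]
    exact pow_le_pow_left₀ (by linarith) h1 2
  have h5 : (σ - t) ^ 2 ≤ δ ^ 2 := pow_le_pow_left₀ he heδ 2
  linarith

/-! ### Separation of the cluster parameters `t = 2uP/(P + c)` -/

/-- The parameter `2uP/(P + c)` of the cluster `(u, c)` (the slope of its line after the projective map). -/
noncomputable def tpar (P u c : ℝ) : ℝ := 2 * u * P / (P + c)

/-- `t ≤ 2u` for `c ≥ 0`. -/
theorem tpar_le {P u c : ℝ} (hP : 0 < P) (hu : 0 ≤ u) (hc : 0 ≤ c) : tpar P u c ≤ 2 * u := by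
  unfold tpar
  rw [div_le_iff₀ (by positivity)]
  nlinarith

/-- Lower bound of the parameter: `2uP/(P + K) ≤ t` for `c ≤ K`. -/
theorem le_tpar {P u c K : ℝ} (hP : 0 < P) (hu : 0 ≤ u) (hc : 0 ≤ c) (hcK : c ≤ K) :
    2 * u * P / (P + K) ≤ tpar P u c := by
  unfold tpar
  exact div_le_div_of_nonneg_left (by positivity) (by positivity) (by linarith)

/-- The parameter is nonnegative. -/
theorem tpar_nonneg {P u c : ℝ} (hP : 0 < P) (hu : 0 ≤ u) (hc : 0 ≤ c) : 0 ≤ tpar P u c := by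
  unfold tpar; positivity

/-- Same slope index, rows differing by at least `1`: the parameters differ by at least `1/(2P)` (`c, c' ≤ K ≤ P`, `u ≥ 1`). -/
theorem tpar_sep_same {P u c c' K : ℝ} (hP : 0 < P) (hu : 1 ≤ u) (hc : 0 ≤ c) (hc' : 0 ≤ c') (hcK : c ≤ K)
    (hc'K : c' ≤ K) (hKP : K ≤ P) (hcc' : 1 ≤ |c - c'|) : 1 / (2 * P) ≤ |tpar P u c - tpar P u c'| := by
  unfold tpar
  have h1 : (0 : ℝ) < P + c := by positivity
  have h2 : (0 : ℝ) < P + c' := by positivity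
  have hsub : 2 * u * P / (P + c) - 2 * u * P / (P + c') = 2 * u * P * (c' - c) / ((P + c) * (P + c')) := by
    field_simp; ring
  rw [hsub, abs_div, abs_of_pos (mul_pos h1 h2), abs_mul, abs_of_pos (by positivity : (0 : ℝ) < 2 * u * P),
    abs_sub_comm, div_le_div_iff₀ (by positivity) (by positivity)]
  have h3 : (P + c) * (P + c') ≤ 2 * P * (2 * P) := by nlinarith
  have h4 : 0 ≤ |c - c'| := abs_nonneg _
  nlinarith [mul_le_mul_of_nonneg_left hcc' (by positivity : (0 : ℝ) ≤ 2 * u * P)]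

/-- Different slope indices (`u + 1 ≤ u'`): the parameters differ by at least `1/2 ≥ 1/(2P)` (`c, c' ∈ [0, K]`, `K ≤ P`,
`2uK ≤ P`, `1 ≤ P`). -/
theorem tpar_sep_lt {P u u' c c' K : ℝ} (hP : 1 ≤ P) (hu : 0 ≤ u) (huu' : u + 1 ≤ u') (hc : 0 ≤ c) (hc' : 0 ≤ c')
    (hc'K : c' ≤ K) (hK : 0 ≤ K) (hKP : K ≤ P) (huK : 2 * u * K ≤ P) :
    1 / (2 * P) ≤ tpar P u' c' - tpar P u c := by
  have hP0 : 0 < P := by linarith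
  have h1 : tpar P u c ≤ 2 * u := tpar_le hP0 hu hc
  have h2 : 2 * u' * P / (P + K) ≤ tpar P u' c' := le_tpar hP0 (by linarith) hc' hc'K
  have h3 : 2 * u + 1 / 2 ≤ 2 * u' * P / (P + K) := by
    rw [le_div_iff₀ (by positivity)]
    have h5 : (u + 1) * P ≤ u' * P := mul_le_mul_of_nonneg_right huu' hP0.le
    nlinarith [h5]
  have h4 : 1 / (2 * P) ≤ 1 / 2 := by
    rw [div_le_div_iff₀ (by positivity) (by norm_num)]
    linarith
  linarith

/-- **Separation.**  For natural slope indices `u ≥ 1`, `u'` and rows `c, c'` (naturals, `≤ K`) with `(u, c) ≠ (u', c')`, under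
`K ≤ P`, `1 ≤ P`, `2uK ≤ P`, `2u'K ≤ P`: `|t(u,c) − t(u',c')| ≥ 1/(2P)`. -/
theorem param_sep {P K : ℝ} {u u' c c' : ℕ} (hP : 1 ≤ P) (hKP : K ≤ P) (hu : 1 ≤ u) (hcK : (c : ℝ) ≤ K)
    (hc'K : (c' : ℝ) ≤ K) (huK : 2 * (u : ℝ) * K ≤ P) (hu'K : 2 * (u' : ℝ) * K ≤ P) (hne : (u, c) ≠ (u', c')) :
    1 / (2 * P) ≤ |tpar P u c - tpar P u' c'| := by
  have hP0 : 0 < P := by linarith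
  have hK : 0 ≤ K := (Nat.cast_nonneg c).trans hcK
  rcases lt_trichotomy u u' with h | h | h
  · have huu' : (u : ℝ) + 1 ≤ u' := by exact_mod_cast h
    have := tpar_sep_lt hP (Nat.cast_nonneg u) huu' (Nat.cast_nonneg c) (Nat.cast_nonneg c') hc'K hK hKP huK
    rw [abs_sub_comm, abs_of_nonneg (by linarith [show (0:ℝ) < 1 / (2 * P) from by positivity])]
    exact this
  · subst h
    have hcc' : c ≠ c' := fun e => hne (by rw [e])
    have h1 : (1 : ℝ) ≤ |(c : ℝ) - c'| := by
      rcases Nat.lt_or_gt_of_ne hcc' with hl | hl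
      · have : (c : ℝ) + 1 ≤ c' := by exact_mod_cast hl
        rw [abs_sub_comm, abs_of_nonneg (by linarith)]
        linarith
      · have : (c' : ℝ) + 1 ≤ c := by exact_mod_cast hl
        rw [abs_of_nonneg (by linarith)]
        linarith
    exact tpar_sep_same hP0 (by exact_mod_cast hu) (Nat.cast_nonneg c) (Nat.cast_nonneg c') hcK hc'K hKP h1
  · have huu' : (u' : ℝ) + 1 ≤ u := by exact_mod_cast h
    have := tpar_sep_lt hP (Nat.cast_nonneg u') huu' (Nat.cast_nonneg c') (Nat.cast_nonneg c) hcK hK hKP hu'K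
    rw [abs_of_nonneg (by linarith [show (0:ℝ) < 1 / (2 * P) from by positivity])]
    exact this

end UVBCex

end TotalsLaw

end Summit.ValiantsHypothesis.ValiantsHypothesis.Theorems.NewtonUnitEquationsDissociatedUniform
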